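import Mathlib.NumberTheory.Padics.Hensel
import Mathlib.NumberTheory.Padics.RingHoms
import Mathlib.Tactic.Module
import Mathlib.RingTheory.Int.Basic
import HarnessLib

/-!
# Crux `PrintCf2.SplitBadTwoRankOneOfFacts` (item stmt-BirchSwinnertonDyer-20368), road α over the CM field:
# the generic EIGEN-DECOMPOSITION `M = M[𝔭^∞] ⊕ M[𝔭̄^∞]` of a `p`-primary group under an endomorphism `π` with
# `π² = tπ − m` whose roots are `p`-adically separated, and the `2`-adic roots of `X² − X + 2`

Cell `bsd-print-cf2`, width seat `bsd-line-cf2-p1-w2` g7; `--supports stmt-BirchSwinnertonDyer-20368` (helper). HONEST FRAMING: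
nothing here closes a crux or a stub; BSD is not proved by any of this; no summit statement is proved by this seat. This is the
linear algebra behind the CM-prime decomposition `E[2^∞] = E[𝔭^∞] ⊕ E[𝔭̄^∞]` of a curve with complex multiplication by
`𝓞 = ℤ[(1 + √−7)/2]` at the SPLIT prime `2 = 𝔭𝔭̄` (companion file `PrintCf2SplitBadTwoCMPrimaryDecompositionAtTwo`), which is
the `Γ_{K₀}`-module the road-α research statement H₂ of the crux's children 27850 / 27851 is to be typed on (planner RULING (y)(4),
LEAD g8 TURNKEY 14:32Z «S3 → H₁ + H₂ once … the W[𝔭₀^∞]-module for H₂ is available»; -w3 g2 `K0ROAD-TURNKEY-w3g2.md` §2).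

THE VOCABULARY (no definition is introduced; everything is stated with the tree's objects). For a `p`-primary abelian group
`M`, an additive `π : M → M` and a `p`-adic integer `r`, «`π` acts on `x` as `r`» is the condition, at EVERY level,
`∀ k N, p^k x = 0 → N ≡ r (mod p^k) → π x = N x` — the same integer-approximation currency as the ordinary-filtration statements
of this cell (`stub_ordinaryFiltrationAtTwo`); no `ℤ_p`-module structure on `M` is used.

* §1 (any prime `p`, any `p`-primary `M`, any `π` with `π² = tπ − m`, `r₁ + r₂ = t`, `r₁r₂ = m`, `r₁ − r₂ ∈ ℤ_p^×`):
  `eigen_of_level` (one level suffices), `exists_addSubgroup_eigen` (the eigen-set of a root is a subgroup),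
  `eq_zero_of_eigen_of_eigen` (disjointness), `exists_eigen_add_eigen` (decomposition `x = x₁ + x₂` by the integral
  idempotents `b(π − N₂)`, `−b(π − N₁)` at level `p^k`, `b(N₁ − N₂) ≡ 1`), `eigen_map_of_commute` / `eigen_map_of_anticommute`
  (maps commuting with `π` preserve, maps with `πg = tg − gπ` interchange the eigen-sets), packaged as
  `exists_eigenDecomposition`: `C₁ ⊓ C₂ = ⊥`, `C₁ ⊔ C₂ = ⊤`, stability, swap.
* §2 `exists_padicInt_two_root`: `r ∈ ℤ₂` with `r² = r − 2`, `‖r‖ < 1`, `r + r̄ = 1`, `r r̄ = 2`, `r − r̄ ∈ ℤ₂^×` (`r̄ = 1 − r`;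
  Hensel at `0`) — `X² − X + 2 ≡ X(X − 1) (mod 2)`: the splitting of `2` in `ℤ[(1+√−7)/2]`.

References: elementary (`ℤ_p[X]/(X² − tX + m) ≅ ℤ_p × ℤ_p` for separated roots); Hensel's lemma (Mathlib `hensels_lemma`).
Background for the use: [SilvermanATAEC1994] II §1; K. Rubin, *Elliptic curves with complex multiplication and the conjecture of
Birch and Swinnerton-Dyer* (LNM 1716), §2; J. Coates, *Infinite descent on elliptic curves with complex multiplication* (1983).
-/

noncomputable section

open scoped Classical

set_option linter.dupNamespace false
set_option autoImplicit false

namespace Summit.BirchSwinnertonDyer.BirchSwinnertonDyer.Theorems.PrintCf2.CMPrimes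

/-! ## §1 Generic: eigen-decomposition of a `p`-primary group under an endomorphism with a quadratic relation
whose roots are `p`-adically separated -/

section Generic

variable {p : ℕ} [Fact p.Prime] {M : Type*} [AddCommGroup M]

/-- Two integers approximating the same `p`-adic integer to order `p^k` are congruent modulo `p^k`. [folklore] -/
theorem pow_dvd_sub_of_sub_mem_span {k : ℕ} {r : ℤ_[p]} {N N' : ℤ}
    (hN : ((N : ℤ_[p]) - r) ∈ (Ideal.span {(p : ℤ_[p]) ^ k} : Ideal ℤ_[p]))
    (hN' : ((N' : ℤ_[p]) - r) ∈ (Ideal.span {(p : ℤ_[p]) ^ k} : Ideal ℤ_[p])) :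
    (p ^ k : ℤ) ∣ N - N' := by
  have h : ((N - N' : ℤ) : ℤ_[p]) ∈ (Ideal.span {(p : ℤ_[p]) ^ k} : Ideal ℤ_[p]) := by
    have := Ideal.sub_mem _ hN hN'
    push_cast
    convert this using 1
    ring
  rw [← PadicInt.norm_int_le_pow_iff_dvd]
  exact (PadicInt.norm_le_pow_iff_mem_span_pow _ _).mpr h

omit [Fact p.Prime] in
/-- On an element killed by `p^k`, integers congruent modulo `p^k` act alike. [folklore] -/
theorem zsmul_eq_zsmul_of_pow_dvd_sub {k : ℕ} {x : M} (hx : p ^ k • x = 0) {N N' : ℤ}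
    (h : (p ^ k : ℤ) ∣ N - N') : N • x = N' • x := by
  obtain ⟨c, hc⟩ := h
  have hpk : ((p : ℤ) ^ k) • x = 0 := by
    rw [show ((p : ℤ) ^ k) = ((p ^ k : ℕ) : ℤ) by push_cast; rfl, natCast_zsmul, hx]
  have h1 : (N - N') • x = 0 := by rw [hc, mul_comm, mul_zsmul, hpk, zsmul_zero]
  rw [sub_smul] at h1
  exact sub_eq_zero.mp h1

/-- **One level suffices.** If `p^k x = 0` and `π x = N₁ x` for ONE integer `N₁ ≡ r (mod p^k)`, then `π` acts on `x` as the
`p`-adic integer `r` at every level: for every `k'` with `p^{k'} x = 0` and every `N ≡ r (mod p^{k'})`, `π x = N x`. [folklore] -/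
theorem eigen_of_level (π : M →+ M) (r : ℤ_[p]) {x : M} {k : ℕ} (hx : p ^ k • x = 0) {N₁ : ℤ}
    (hN₁ : ((N₁ : ℤ_[p]) - r) ∈ (Ideal.span {(p : ℤ_[p]) ^ k} : Ideal ℤ_[p])) (h : π x = N₁ • x) :
    ∀ (k' : ℕ) (N : ℤ), p ^ k' • x = 0 →
      ((N : ℤ_[p]) - r) ∈ (Ideal.span {(p : ℤ_[p]) ^ k'} : Ideal ℤ_[p]) → π x = N • x := by
  intro k' N hk' hN
  rw [h]
  -- work at level `j = min k k'`
  have hle : ∀ {j i : ℕ}, j ≤ i → (Ideal.span {(p : ℤ_[p]) ^ i} : Ideal ℤ_[p]) ≤ Ideal.span {(p : ℤ_[p]) ^ j} :=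
    fun hji ↦ Ideal.span_singleton_le_span_singleton.mpr (pow_dvd_pow _ hji)
  have hxj : p ^ min k k' • x = 0 := by
    rcases le_total k k' with hkk | hkk
    · rw [min_eq_left hkk, hx]
    · rw [min_eq_right hkk, hk']
  exact zsmul_eq_zsmul_of_pow_dvd_sub hxj
    (pow_dvd_sub_of_sub_mem_span (hle (min_le_left k k') hN₁) (hle (min_le_right k k') hN))

/-- An integer approximation of a `p`-adic integer to order `p^k` exists. [folklore] -/
theorem exists_int_sub_mem_span (r : ℤ_[p]) (k : ℕ) :
    ∃ N : ℤ, ((N : ℤ_[p]) - r) ∈ (Ideal.span {(p : ℤ_[p]) ^ k} : Ideal ℤ_[p]) := by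
  refine ⟨(PadicInt.appr r k : ℤ), ?_⟩
  have h := PadicInt.appr_spec k r
  rw [← Ideal.neg_mem_iff, neg_sub] at h
  push_cast
  exact h

/-- **The eigen-set of a root is a subgroup.** For a `p`-primary `M`, an additive `π : M → M` and `r ∈ ℤ_p`, the elements
on which `π` acts as `r` (at every level) form a subgroup. [folklore] -/
theorem exists_addSubgroup_eigen (hM : ∀ x : M, ∃ k : ℕ, p ^ k • x = 0) (π : M →+ M) (r : ℤ_[p]) :
    ∃ C : AddSubgroup M, ∀ x, x ∈ C ↔
      ∀ (k : ℕ) (N : ℤ), p ^ k • x = 0 →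
        ((N : ℤ_[p]) - r) ∈ (Ideal.span {(p : ℤ_[p]) ^ k} : Ideal ℤ_[p]) → π x = N • x := by
  refine ⟨{ carrier := {x | ∀ (k : ℕ) (N : ℤ), p ^ k • x = 0 →
              ((N : ℤ_[p]) - r) ∈ (Ideal.span {(p : ℤ_[p]) ^ k} : Ideal ℤ_[p]) → π x = N • x}
            zero_mem' := fun k N _ _ ↦ by rw [map_zero, zsmul_zero]
            add_mem' := ?_
            neg_mem' := ?_ }, fun x ↦ Iff.rfl⟩
  · intro x y hx hy
    obtain ⟨kx, hkx⟩ := hM x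
    obtain ⟨ky, hky⟩ := hM y
    -- a common level
    have hKx : p ^ (kx + ky) • x = 0 := by rw [pow_add, mul_comm, mul_smul, hkx, smul_zero]
    have hKy : p ^ (kx + ky) • y = 0 := by rw [pow_add, mul_smul, hky, smul_zero]
    have hKxy : p ^ (kx + ky) • (x + y) = 0 := by rw [smul_add, hKx, hKy, add_zero]
    obtain ⟨N', hN'⟩ := exists_int_sub_mem_span r (kx + ky)
    have hπ : π (x + y) = N' • (x + y) := by
      rw [map_add, hx _ _ hKx hN', hy _ _ hKy hN', zsmul_add]
    exact eigen_of_level π r hKxy hN' hπ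
  · intro x hx k N hk hN
    rw [map_neg, hx k N (by rwa [smul_neg, neg_eq_zero] at hk) hN, zsmul_neg]

/-- From `N ≡ unit (mod p^k)` in `ℤ_p`: `N` is prime to `p^k` in `ℤ` (Bézout form). [folklore] -/
theorem isCoprime_pow_of_sub_mem_span_of_isUnit {k : ℕ} {u : ℤ_[p]} (hu : IsUnit u) {N : ℤ}
    (hN : ((N : ℤ_[p]) - u) ∈ (Ideal.span {(p : ℤ_[p]) ^ k} : Ideal ℤ_[p])) :
    IsCoprime ((p : ℤ) ^ k) N := by
  rcases Nat.eq_zero_or_pos k with rfl | hk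
  · rw [pow_zero]; exact isCoprime_one_left
  · apply IsCoprime.pow_left
    rw [Irreducible.coprime_iff_not_dvd (Int.prime_iff_natAbs_prime.mpr (by simpa using Fact.out (p := p.Prime))).irreducible]
    intro hdvd
    -- then `p ∣ u` in `ℤ_p`, contradicting `u` a unit
    have h1 : (p : ℤ_[p]) ∣ (N : ℤ_[p]) := by
      obtain ⟨c, hc⟩ := hdvd
      exact ⟨c, by rw [hc]; push_cast; ring⟩
    have h2 : (p : ℤ_[p]) ∣ (N : ℤ_[p]) - u := by
      have : (p : ℤ_[p]) ∣ (p : ℤ_[p]) ^ k := dvd_pow_self _ hk.ne'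
      exact this.trans (Ideal.mem_span_singleton.mp hN)
    have h3 : (p : ℤ_[p]) ∣ u := by
      have := dvd_sub h1 h2
      rwa [sub_sub_cancel] at this
    have h4 : ‖u‖ < 1 := (PadicInt.norm_lt_one_iff_dvd u).mpr h3
    exact absurd (PadicInt.isUnit_iff.mp hu) h4.ne

/-- Sums and products of approximations: if `N₁ ≡ r₁`, `N₂ ≡ r₂ (mod p^k)` with `r₁ + r₂ = t`, `r₁ r₂ = m` (integers `t, m`),
then `p^k ∣ N₁ + N₂ − t` and `p^k ∣ N₁ N₂ − m`. [folklore] -/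
theorem pow_dvd_add_sub_and_mul_sub {k : ℕ} {r₁ r₂ : ℤ_[p]} {t m N₁ N₂ : ℤ} (hsum : r₁ + r₂ = t)
    (hprod : r₁ * r₂ = m)
    (hN₁ : ((N₁ : ℤ_[p]) - r₁) ∈ (Ideal.span {(p : ℤ_[p]) ^ k} : Ideal ℤ_[p]))
    (hN₂ : ((N₂ : ℤ_[p]) - r₂) ∈ (Ideal.span {(p : ℤ_[p]) ^ k} : Ideal ℤ_[p])) :
    (p ^ k : ℤ) ∣ N₁ + N₂ - t ∧ (p ^ k : ℤ) ∣ N₁ * N₂ - m := by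
  constructor
  · have h : (((N₁ + N₂ : ℤ) : ℤ_[p]) - (t : ℤ_[p])) ∈ (Ideal.span {(p : ℤ_[p]) ^ k} : Ideal ℤ_[p]) := by
      have := Ideal.add_mem _ hN₁ hN₂
      rw [← hsum]; push_cast
      convert this using 1; ring
    have h' := pow_dvd_sub_of_sub_mem_span (r := (t : ℤ_[p])) h (N' := t) (by rw [sub_self]; exact Ideal.zero_mem _)
    exact h'
  · have h : (((N₁ * N₂ : ℤ) : ℤ_[p]) - (m : ℤ_[p])) ∈ (Ideal.span {(p : ℤ_[p]) ^ k} : Ideal ℤ_[p]) := by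
      have := Ideal.add_mem _ (Ideal.mul_mem_left _ (N₁ : ℤ_[p]) hN₂) (Ideal.mul_mem_right r₂ _ hN₁)
      rw [← hprod]; push_cast
      convert this using 1; ring
    exact pow_dvd_sub_of_sub_mem_span (r := (m : ℤ_[p])) h (N' := m) (by rw [sub_self]; exact Ideal.zero_mem _)

/-- **Disjointness.** If `π` acts on `x` as `r₁` and as `r₂` with `r₁ − r₂` a `p`-adic unit, then `x = 0`. [folklore] -/
theorem eq_zero_of_eigen_of_eigen (hM : ∀ x : M, ∃ k : ℕ, p ^ k • x = 0) (π : M →+ M) {r₁ r₂ : ℤ_[p]}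
    (hunit : IsUnit (r₁ - r₂)) {x : M}
    (h₁ : ∀ (k : ℕ) (N : ℤ), p ^ k • x = 0 →
      ((N : ℤ_[p]) - r₁) ∈ (Ideal.span {(p : ℤ_[p]) ^ k} : Ideal ℤ_[p]) → π x = N • x)
    (h₂ : ∀ (k : ℕ) (N : ℤ), p ^ k • x = 0 →
      ((N : ℤ_[p]) - r₂) ∈ (Ideal.span {(p : ℤ_[p]) ^ k} : Ideal ℤ_[p]) → π x = N • x) : x = 0 := by
  obtain ⟨k, hk⟩ := hM x
  obtain ⟨N₁, hN₁⟩ := exists_int_sub_mem_span r₁ k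
  obtain ⟨N₂, hN₂⟩ := exists_int_sub_mem_span r₂ k
  have hdiff : (((N₁ - N₂ : ℤ) : ℤ_[p]) - (r₁ - r₂)) ∈ (Ideal.span {(p : ℤ_[p]) ^ k} : Ideal ℤ_[p]) := by
    have := Ideal.sub_mem _ hN₁ hN₂
    push_cast
    convert this using 1; ring
  obtain ⟨a, b, hab⟩ := isCoprime_pow_of_sub_mem_span_of_isUnit hunit hdiff
  have hx0 : (N₁ - N₂) • x = 0 := by rw [sub_smul, ← h₁ k N₁ hk hN₁, ← h₂ k N₂ hk hN₂, sub_self]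
  have hpk : ((p : ℤ) ^ k) • x = 0 := by
    rw [show ((p : ℤ) ^ k) = ((p ^ k : ℕ) : ℤ) by push_cast; rfl, natCast_zsmul, hk]
  calc x = (a * (p : ℤ) ^ k + b * (N₁ - N₂)) • x := by rw [hab, one_smul]
    _ = 0 := by rw [add_smul, mul_smul, mul_smul, hpk, hx0, smul_zero, smul_zero, add_zero]

/-- **Decomposition.** With two `p`-adically separated roots `r₁, r₂` of the relation `π² = tπ − m` (`r₁ + r₂ = t`, `r₁r₂ = m`,
`r₁ − r₂` a unit), every `x` is `x₁ + x₂` with `π` acting on `xᵢ` as `rᵢ`: at level `p^k`, with `b(N₁ − N₂) ≡ 1`,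
`x₁ = b(πx − N₂x)`, `x₂ = −b(πx − N₁x)`. [folklore] -/
theorem exists_eigen_add_eigen (hM : ∀ x : M, ∃ k : ℕ, p ^ k • x = 0) (π : M →+ M) {t m : ℤ}
    (hπ : ∀ x, π (π x) = t • π x - m • x) {r₁ r₂ : ℤ_[p]} (hsum : r₁ + r₂ = t) (hprod : r₁ * r₂ = m)
    (hunit : IsUnit (r₁ - r₂)) (x : M) :
    ∃ x₁ x₂ : M,
      (∀ (k : ℕ) (N : ℤ), p ^ k • x₁ = 0 →
        ((N : ℤ_[p]) - r₁) ∈ (Ideal.span {(p : ℤ_[p]) ^ k} : Ideal ℤ_[p]) → π x₁ = N • x₁) ∧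
      (∀ (k : ℕ) (N : ℤ), p ^ k • x₂ = 0 →
        ((N : ℤ_[p]) - r₂) ∈ (Ideal.span {(p : ℤ_[p]) ^ k} : Ideal ℤ_[p]) → π x₂ = N • x₂) ∧
      x = x₁ + x₂ := by
  obtain ⟨k, hk⟩ := hM x
  obtain ⟨N₁, hN₁⟩ := exists_int_sub_mem_span r₁ k
  obtain ⟨N₂, hN₂⟩ := exists_int_sub_mem_span r₂ k
  have hdiff : (((N₁ - N₂ : ℤ) : ℤ_[p]) - (r₁ - r₂)) ∈ (Ideal.span {(p : ℤ_[p]) ^ k} : Ideal ℤ_[p]) := by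
    have := Ideal.sub_mem _ hN₁ hN₂
    push_cast
    convert this using 1; ring
  obtain ⟨a, b, hab⟩ := isCoprime_pow_of_sub_mem_span_of_isUnit hunit hdiff
  obtain ⟨hst, hpm⟩ := pow_dvd_add_sub_and_mul_sub hsum hprod hN₁ hN₂
  -- `p^k` kills `x` and `π x`
  have hkπ : p ^ k • π x = 0 := by rw [← map_nsmul, hk, map_zero]
  have hpk : ((p : ℤ) ^ k) • x = 0 := by
    rw [show ((p : ℤ) ^ k) = ((p ^ k : ℕ) : ℤ) by push_cast; rfl, natCast_zsmul, hk]
  -- the congruences, as vanishing scalar actions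
  have h1 : (N₁ + N₂ - t) • π x = 0 := by
    have := zsmul_eq_zsmul_of_pow_dvd_sub hkπ (N := N₁ + N₂ - t) (N' := 0) (by rwa [sub_zero])
    rwa [zero_smul] at this
  have h2 : (N₁ * N₂ - m) • x = 0 := by
    have := zsmul_eq_zsmul_of_pow_dvd_sub hk (N := N₁ * N₂ - m) (N' := 0) (by rwa [sub_zero])
    rwa [zero_smul] at this
  refine ⟨b • (π x - N₂ • x), (-b) • (π x - N₁ • x), ?_, ?_, ?_⟩
  · -- `x₁` at level `k` with `N₁`
    refine eigen_of_level π r₁ (k := k) ?_ hN₁ ?_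
    · rw [smul_comm, smul_sub, hkπ, smul_comm, hk, smul_zero, sub_self, smul_zero]
    · have e : π (b • (π x - N₂ • x)) - N₁ • (b • (π x - N₂ • x)) =
          b • (-((N₁ + N₂ - t) • π x) + (N₁ * N₂ - m) • x) := by
        simp only [map_zsmul, map_sub, hπ x]
        module
      rw [h1, h2, neg_zero, add_zero, smul_zero, sub_eq_zero] at e
      exact e
  · -- `x₂` at level `k` with `N₂`
    refine eigen_of_level π r₂ (k := k) ?_ hN₂ ?_
    · rw [smul_comm, smul_sub, hkπ, smul_comm, hk, smul_zero, sub_self, smul_zero]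
    · have e : π ((-b) • (π x - N₁ • x)) - N₂ • ((-b) • (π x - N₁ • x)) =
          (-b) • (-((N₁ + N₂ - t) • π x) + (N₁ * N₂ - m) • x) := by
        simp only [map_zsmul, map_sub, hπ x]
        module
      rw [h1, h2, neg_zero, add_zero, smul_zero, sub_eq_zero] at e
      exact e
  · -- `x = x₁ + x₂`
    have e : b • (π x - N₂ • x) + (-b) • (π x - N₁ • x) = (b * (N₁ - N₂)) • x := by
      simp only [smul_sub, neg_smul, mul_smul, sub_smul, smul_sub]; abel
    rw [e]
    calc x = (a * (p : ℤ) ^ k + b * (N₁ - N₂)) • x := by rw [hab, one_smul]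
      _ = (b * (N₁ - N₂)) • x := by rw [add_smul, mul_smul, hpk, smul_zero, zero_add]

/-- **Stability under commuting endomorphisms.** If `g` commutes with `π`, then `g` preserves each eigen-set (e.g. every Galois
automorphism commuting with a rational endomorphism `π`). [folklore] -/
theorem eigen_map_of_commute (π g : M →+ M) (hg : ∀ x, g (π x) = π (g x)) (r : ℤ_[p]) {x : M}
    (hxM : ∃ k : ℕ, p ^ k • x = 0)
    (hx : ∀ (k : ℕ) (N : ℤ), p ^ k • x = 0 →
      ((N : ℤ_[p]) - r) ∈ (Ideal.span {(p : ℤ_[p]) ^ k} : Ideal ℤ_[p]) → π x = N • x) :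
    ∀ (k : ℕ) (N : ℤ), p ^ k • g x = 0 →
      ((N : ℤ_[p]) - r) ∈ (Ideal.span {(p : ℤ_[p]) ^ k} : Ideal ℤ_[p]) → π (g x) = N • g x := by
  obtain ⟨k, hk⟩ := hxM
  obtain ⟨N₁, hN₁⟩ := exists_int_sub_mem_span r k
  refine eigen_of_level π r (k := k) (by rw [← map_nsmul, hk, map_zero]) hN₁ ?_
  rw [← hg, hx k N₁ hk hN₁, map_zsmul]

/-- **Swap under anti-commuting endomorphisms.** If `g π = (t − π) g` (e.g. a Galois automorphism acting on a CM
endomorphism `π` as complex conjugation, `π ↦ π̄ = t − π`), then `g` maps the `r₁`-eigen-set to the `r₂`-eigen-set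
(`r₁ + r₂ = t`). [folklore] -/
theorem eigen_map_of_anticommute (π g : M →+ M) {t : ℤ} (hg : ∀ x, π (g x) = t • g x - g (π x)) {r₁ r₂ : ℤ_[p]}
    (hsum : r₁ + r₂ = t) {x : M} (hxM : ∃ k : ℕ, p ^ k • x = 0)
    (hx : ∀ (k : ℕ) (N : ℤ), p ^ k • x = 0 →
      ((N : ℤ_[p]) - r₁) ∈ (Ideal.span {(p : ℤ_[p]) ^ k} : Ideal ℤ_[p]) → π x = N • x) :
    ∀ (k : ℕ) (N : ℤ), p ^ k • g x = 0 →
      ((N : ℤ_[p]) - r₂) ∈ (Ideal.span {(p : ℤ_[p]) ^ k} : Ideal ℤ_[p]) → π (g x) = N • g x := by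
  obtain ⟨k, hk⟩ := hxM
  obtain ⟨N₁, hN₁⟩ := exists_int_sub_mem_span r₁ k
  have hN₂ : (((t - N₁ : ℤ) : ℤ_[p]) - r₂) ∈ (Ideal.span {(p : ℤ_[p]) ^ k} : Ideal ℤ_[p]) := by
    rw [← Ideal.neg_mem_iff]
    push_cast
    rw [← hsum]
    convert hN₁ using 1; ring
  refine eigen_of_level π r₂ (k := k) (by rw [← map_nsmul, hk, map_zero]) hN₂ ?_
  rw [hg, hx k N₁ hk hN₁, map_zsmul, sub_smul]

/-- **The eigen-decomposition, packaged.** `M` a `p`-primary abelian group, `π : M →+ M` with `π² = tπ − m`, `r₁, r₂ ∈ ℤ_p` with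
`r₁ + r₂ = t`, `r₁ r₂ = m`, `r₁ − r₂ ∈ ℤ_p^×`. Then there are subgroups `C₁, C₂ ≤ M` — the elements on which `π` acts as `r₁`,
resp. `r₂`, at every level — with `C₁ ⊓ C₂ = ⊥`, `C₁ ⊔ C₂ = ⊤`, each preserved by every additive map commuting with `π` and
interchanged by every additive map `g` with `πg = tg − gπ`. (Linear algebra of `ℤ_p[X]/(X² − tX + m) ≅ ℤ_p × ℤ_p`.) [folklore] -/
theorem exists_eigenDecomposition (hM : ∀ x : M, ∃ k : ℕ, p ^ k • x = 0) (π : M →+ M) {t m : ℤ}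
    (hπ : ∀ x, π (π x) = t • π x - m • x) {r₁ r₂ : ℤ_[p]} (hsum : r₁ + r₂ = t) (hprod : r₁ * r₂ = m)
    (hunit : IsUnit (r₁ - r₂)) :
    ∃ C₁ C₂ : AddSubgroup M,
      (∀ x, x ∈ C₁ ↔ ∀ (k : ℕ) (N : ℤ), p ^ k • x = 0 →
        ((N : ℤ_[p]) - r₁) ∈ (Ideal.span {(p : ℤ_[p]) ^ k} : Ideal ℤ_[p]) → π x = N • x) ∧
      (∀ x, x ∈ C₂ ↔ ∀ (k : ℕ) (N : ℤ), p ^ k • x = 0 →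
        ((N : ℤ_[p]) - r₂) ∈ (Ideal.span {(p : ℤ_[p]) ^ k} : Ideal ℤ_[p]) → π x = N • x) ∧
      C₁ ⊓ C₂ = ⊥ ∧ C₁ ⊔ C₂ = ⊤ ∧
      (∀ g : M →+ M, (∀ x, g (π x) = π (g x)) → (∀ x ∈ C₁, g x ∈ C₁) ∧ (∀ x ∈ C₂, g x ∈ C₂)) ∧
      (∀ g : M →+ M, (∀ x, π (g x) = t • g x - g (π x)) → (∀ x ∈ C₁, g x ∈ C₂) ∧ (∀ x ∈ C₂, g x ∈ C₁)) := by
  obtain ⟨C₁, hC₁⟩ := exists_addSubgroup_eigen hM π r₁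
  obtain ⟨C₂, hC₂⟩ := exists_addSubgroup_eigen hM π r₂
  have hsum' : r₂ + r₁ = t := by rw [add_comm, hsum]
  have hunit' : IsUnit (r₂ - r₁) := by rw [← neg_sub]; exact hunit.neg
  refine ⟨C₁, C₂, hC₁, hC₂, ?_, ?_, ?_, ?_⟩
  · rw [eq_bot_iff]
    intro x hx
    rw [AddSubgroup.mem_inf] at hx
    exact (AddSubgroup.mem_bot).mpr
      (eq_zero_of_eigen_of_eigen hM π hunit ((hC₁ x).mp hx.1) ((hC₂ x).mp hx.2))
  · rw [eq_top_iff]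
    intro x _
    obtain ⟨x₁, x₂, h₁, h₂, rfl⟩ := exists_eigen_add_eigen hM π hπ hsum hprod hunit x
    exact AddSubgroup.add_mem_sup ((hC₁ x₁).mpr h₁) ((hC₂ x₂).mpr h₂)
  · intro g hg
    exact ⟨fun x hx ↦ (hC₁ _).mpr (eigen_map_of_commute π g hg r₁ (hM x) ((hC₁ x).mp hx)),
      fun x hx ↦ (hC₂ _).mpr (eigen_map_of_commute π g hg r₂ (hM x) ((hC₂ x).mp hx))⟩
  · intro g hg
    exact ⟨fun x hx ↦ (hC₂ _).mpr (eigen_map_of_anticommute π g hg hsum (hM x) ((hC₁ x).mp hx)),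
      fun x hx ↦ (hC₁ _).mpr (eigen_map_of_anticommute π g hg hsum' (hM x) ((hC₂ x).mp hx))⟩

end Generic

/-! ## §2 The roots of `X² − X + 2` in `ℤ₂` (Hensel): `r` with `‖r‖ < 1` and `r̄ = 1 − r`, `r − r̄ = 2r − 1 ∈ ℤ₂^×` -/

/-- **`X² − X + 2 = (X − r)(X − r̄)` over `ℤ₂`.** There is `r ∈ ℤ₂` with `r² = r − 2` and `‖r‖ < 1` (Hensel's lemma at `a = 0`:
`‖f(0)‖ = ‖2‖ < 1 = ‖f′(0)‖²`); then `r̄ := 1 − r` is the other root (`r + r̄ = 1`, `r r̄ = 2`) and `r − r̄ = 2r − 1` is a unit.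
This is the splitting `2 = 𝔭𝔭̄` in `ℤ[(1 + √−7)/2]`, read `2`-adically. [folklore] -/
theorem exists_padicInt_two_root :
    ∃ r : ℤ_[2], r * r = r - 2 ∧ ‖r‖ < 1 ∧ r + (1 - r) = (1 : ℤ) ∧ r * (1 - r) = (2 : ℤ) ∧
      IsUnit (r - (1 - r)) := by
  haveI : Fact (Nat.Prime 2) := ⟨Nat.prime_two⟩
  set F : Polynomial ℤ_[2] := Polynomial.X ^ 2 - Polynomial.X + Polynomial.C 2 with hF
  have hF0 : F.eval 0 = 2 := by simp [hF]
  have hF' : F.derivative.eval 0 = -1 := by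
    simp [hF, Polynomial.derivative_sub, Polynomial.derivative_pow]
  have hnorm : ‖F.eval 0‖ < ‖F.derivative.eval 0‖ ^ 2 := by
    rw [hF0, hF', norm_neg, norm_one, one_pow]
    have : ‖(2 : ℤ_[2])‖ = ‖((2 : ℕ) : ℤ_[2])‖ := by norm_cast
    rw [this, PadicInt.norm_p]; norm_num
  obtain ⟨r, hr, hlt, -, -⟩ := hensels_lemma hnorm
  have hr2 : r * r = r - 2 := by
    have : r ^ 2 - r + 2 = 0 := by simpa [hF] using hr
    linear_combination this
  have hrlt : ‖r‖ < 1 := by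
    rw [Polynomial.coe_aeval_eq_eval, hF', norm_neg, norm_one, sub_zero] at hlt; exact hlt
  refine ⟨r, hr2, hrlt, by push_cast; ring, by push_cast; linear_combination -hr2, ?_⟩
  -- `r − (1 − r) = 2r − 1` is a unit: `‖2r‖ < 1`
  have h2r : ‖(2 : ℤ_[2]) * r‖ < 1 := by
    rw [norm_mul]
    calc ‖(2 : ℤ_[2])‖ * ‖r‖ ≤ 1 * ‖r‖ := by gcongr; exact PadicInt.norm_le_one _
      _ < 1 := by rw [one_mul]; exact hrlt
  -- `‖1 − 2r‖ = 1` since `‖2r‖ < 1 = ‖1‖` (ultrametric)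
  have hne : ‖(1 : ℤ_[2])‖ ≠ ‖-((2 : ℤ_[2]) * r)‖ := by
    rw [norm_one, norm_neg]; exact ne_of_gt h2r
  have h1 : ‖(1 : ℤ_[2]) + -((2 : ℤ_[2]) * r)‖ = 1 := by
    rw [PadicInt.norm_add_eq_max_of_ne hne, norm_one, norm_neg, max_eq_left h2r.le]
  have e : r - (1 - r) = -(1 + -(2 * r)) := by ring
  rw [e, IsUnit.neg_iff, PadicInt.isUnit_iff, h1]

end Summit.BirchSwinnertonDyer.BirchSwinnertonDyer.Theorems.PrintCf2.CMPrimes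

end
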